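import Summits.Ventures.LatticeQCDFlow.Scaling.FiniteOddsMixtureReduction
import Summits.Ventures.LatticeQCDFlow.Scaling.UrnProductCertificate

/-!
HONEST FRAMING: exact (Metropolis-corrected) sampling algorithms for lattice gauge theory; figures
of merit are autocorrelation/cost numbers at stated couplings and volumes; no continuum-physics
claim.

# FiniteOddsPersistenceForm — WITH THE WEIGHTS `θ = 1/(1+pW)` THE FINITE-ODDS CRITERION IS A STATEMENT ABOUT THE EXPECTED EFFECTIVE PERSISTENCE `ω = Wθ` OF THE TWO
# DELETED PARTICLES: `1 − θ = p·ω`, `1 − θ̄ = p·E_{μ_1}θ`, AND `Ψ_σ` CONTRACTS AT RATE `ρ` AS SOON AS `p·(E_ũX ω + E_ũY ω) + (ρ/σ)Φ ≤ G̃(Φ+e−2)/Δ + 2p·E_{μ_1}θ`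
# — AT `τ = ∞` THIS IS CHAPTER V FILE 6 (`E_urn ω = M/Z`), AT FINITE ODDS IT IS THE ONE INEQUALITY LEFT (lean-2 GEN-36, ours)

Venture-side (OURS).  Cell `lqcd-flow` (pub-lqcd), unit `pub-lqcd-lean-2-g36`, 2026-08-29.  Chapter W (item 1 (i) at finite swap odds), file 6.  Setting of chapter V: `W > 0`,
`p ≥ 0`, `p·W ≤ 1`, `θ_v = 1/(1+pW_v)`, `Σ μ_0 = 1`, `Σ μ_0 W = 1` (`μ_1 = μ_0W`).  The EFFECTIVE PERSISTENCE `ω_v = W_vθ_v = W_v/(1+pW_v) ∈ (0, 1/(2p)]` satisfies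
`1 − θ_v = p·ω_v` (`persist_one_sub_theta`), so the deleted-mass terms of the product criterion are `R̃ = E_ũ θ = 1 − p·E_ũ ω` and the fresh mass is `θ̄ = 1 − p·Σ_v μ_0(v)ω_v`
with `Σ μ_0 ω = Σ μ_1 θ = E_{μ_1}θ ∈ [½, 1]` (`persist_fresh`, `persist_fresh_mem`).  Substituting in `Scaling/FiniteOddsMixtureReduction` (`finiteOdds_product_contract` with
`r = θ`, `r_max = 1`, `r̄ = θ̄`): **the mixture coupling contracts `Ψ_σ = Δ·Φ` by `1 − ρ` as soon as
`ρΔΦ ≤ σ·[G̃(Φ + e − 2) + pΔ·(2E_{μ_1}θ − E_ũX ω − E_ũY ω)]`** (`finiteOdds_persistence_contract`), i.e. the expected effective persistence of the two deleted particles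
(after at least one attempt) exceeds twice its cold-law mean `E_{μ_1}θ = E_{μ_0}ω` by at most the gain's leverage `G̃(Φ+e−2)/(pΔ)` minus the rate term.  At `τ = ∞`
(`ũ` = urn law) `E_urn ω = M/Z` and chapter V file 6's `G ≥ pΔ/Z_min` is exactly this inequality with room `2pE_{μ_1}θ ≥ p`.  One pair state, hypothesis-equations.

## What is proved

* §1 `persist_one_sub_theta` (`1 − θ_v = pW_vθ_v`), `persist_nonneg`, `persist_le` (`W_vθ_v ≤ W_v`), `persist_expect` (`Σ u θ = Σ u − p·Σ u Wθ`), `persist_fresh`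
  (`Σ μ_0 θ = 1 − p·Σ μ_0 Wθ`), `persist_fresh_eq_cold` (`Σ μ_0 Wθ = Σ μ_1 θ` for `μ_1 = μ_0 W`), `persist_fresh_mem` (`½ ≤ Σ μ_0 Wθ ≤ 1`).
* §2 **`finiteOdds_persistence_contract`**, `finiteOdds_persistence_criterion_of_le` (monotonicity in the two persistence expectations: upper bounds suffice).

Reading (toy of this generation, `lean-2/work-gen36/numerics/`, NOTHING CLAIMED): the optimal coupling of the tail laws was monotone in every pair state examined; with the
constant `2` in `Φ` (chapter V file 6's choice) the criterion value per unit `σΔ` has `min ≥ 0.9p` at `τ = 1` over 22 laws at `K ≤ 12`, but two families show that `Ψ_σ` with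
constant `2` is NOT a law-free certificate at finite odds: «unit-persistence hub, super-persistent levels» has the `K → ∞`, `p → 0` limit `val/p → τ² + τ − 1` (threshold at the
golden ratio), and «hot law ≈ cold law plus rare strongly preferred contents» has `val = O(p²)` for `K ≳ 1/p` at every finite `τ` (the joint deletion of a light common particle
raises the mass by `≈ 1` at probability `≈ 2σp`, cancelling the gain's leverage up to `2(1−θ̄)`).  Both are repaired by a LARGER CONSTANT: with `Φ = (2K+2) + Σθ(N_X+N_Y) − 2(1−σ)θ_z` the toy finds `val ≥ 2(1−θ̄) ≥ p` in EVERY pair state of every law tried (25 named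
+ 300 random laws, `τ ∈ [0.05, 4]`, K-stable to 256), and `Scaling/OneAttemptCertificate` PROVES exactly this for the one-attempt laws (the theorem here is stated for an arbitrary `Φ`).
NOT CLAIMED: any bound on `E_ũ ω`.  Literature grade (cell rule): OWN, elementary; nothing cited as a fact; no new bib keys.
-/

open Finset
open Literature.Probability.MarkovChains

namespace Summit.Ventures.LatticeQCDFlow.Scaling

section Persistence
variable {S : Type*} [Fintype S] [DecidableEq S]
variable {W θ μ0 μ1 : S → ℝ} {p : ℝ}

/-! ## §1 The effective persistence `ω = Wθ` -/

omit [Fintype S] [DecidableEq S] in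
/-- **`1 − θ_v = p·W_v·θ_v`.** [ours] -/
theorem persist_one_sub_theta (hW : ∀ v, 0 < W v) (hp0 : 0 ≤ p) (hθ : ∀ v, θ v = 1 / (1 + p * W v)) (v : S) :
    1 - θ v = p * (W v * θ v) := by
  have hden : 0 < 1 + p * W v := by nlinarith [mul_nonneg hp0 (hW v).le]
  rw [hθ v]; field_simp; ring

omit [Fintype S] [DecidableEq S] in
/-- `ω_v = W_vθ_v ≥ 0`. [ours] -/
theorem persist_nonneg (hW : ∀ v, 0 < W v) (hp0 : 0 ≤ p) (hθ : ∀ v, θ v = 1 / (1 + p * W v)) (v : S) : 0 ≤ W v * θ v := by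
  have hθ0 : 0 ≤ θ v := by rw [hθ v]; have := mul_nonneg hp0 (hW v).le; positivity
  exact mul_nonneg (hW v).le hθ0

omit [Fintype S] [DecidableEq S] in
/-- `ω_v ≤ W_v`. [ours] -/
theorem persist_le (hW : ∀ v, 0 < W v) (hp0 : 0 ≤ p) (hp : ∀ v, p * W v ≤ 1) (hθ : ∀ v, θ v = 1 / (1 + p * W v)) (v : S) :
    W v * θ v ≤ W v :=
  mul_le_of_le_one_right (hW v).le (theta_mem hW hp0 hp hθ v).2

omit [DecidableEq S] in
/-- **Deleted mass in persistence form:** `Σ u θ = Σ u − p·Σ u·(Wθ)`. [ours] -/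
theorem persist_expect (hW : ∀ v, 0 < W v) (hp0 : 0 ≤ p) (hθ : ∀ v, θ v = 1 / (1 + p * W v)) (u : S → ℝ) :
    ∑ v, u v * θ v = ∑ v, u v - p * ∑ v, u v * (W v * θ v) := by
  rw [mul_sum, ← sum_sub_distrib]
  refine sum_congr rfl fun v _ => ?_
  have h := persist_one_sub_theta hW hp0 hθ v
  calc u v * θ v = u v * (1 - (1 - θ v)) := by ring
    _ = u v - p * (u v * (W v * θ v)) := by rw [h]; ring

omit [DecidableEq S] in
/-- **Fresh mass in persistence form:** `Σ μ_0 θ = 1 − p·Σ μ_0 Wθ` (`Σ μ_0 = 1`). [ours] -/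
theorem persist_fresh (hW : ∀ v, 0 < W v) (hp0 : 0 ≤ p) (hθ : ∀ v, θ v = 1 / (1 + p * W v)) (hμ1 : ∑ v, μ0 v = 1) :
    ∑ v, μ0 v * θ v = 1 - p * ∑ v, μ0 v * (W v * θ v) := by
  rw [persist_expect hW hp0 hθ μ0, hμ1]

omit [DecidableEq S] in
/-- `Σ μ_0·(Wθ) = Σ μ_1 θ` for `μ_1 = μ_0·W`: the fresh particle's mean effective persistence is the cold law's mean weight. [ours] -/
theorem persist_fresh_eq_cold (hμ1W : ∀ v, μ1 v = μ0 v * W v) : ∑ v, μ0 v * (W v * θ v) = ∑ v, μ1 v * θ v :=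
  sum_congr rfl fun v _ => by rw [hμ1W v]; ring

omit [DecidableEq S] in
/-- **`½ ≤ Σ μ_0 Wθ ≤ 1`** (`μ_0 ≥ 0`, `Σ μ_0 W = 1`, `p·W ≤ 1`). [ours] -/
theorem persist_fresh_mem (hW : ∀ v, 0 < W v) (hp0 : 0 ≤ p) (hp : ∀ v, p * W v ≤ 1) (hθ : ∀ v, θ v = 1 / (1 + p * W v))
    (hμ0 : ∀ v, 0 ≤ μ0 v) (hμW : ∑ v, μ0 v * W v = 1) :
    1 / 2 ≤ ∑ v, μ0 v * (W v * θ v) ∧ ∑ v, μ0 v * (W v * θ v) ≤ 1 := by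
  constructor
  · calc (1 : ℝ) / 2 = ∑ v, μ0 v * W v * (1 / 2) := by rw [← sum_mul, hμW, one_mul]
      _ ≤ ∑ v, μ0 v * (W v * θ v) := sum_le_sum fun v _ => by
          rw [← mul_assoc]
          exact mul_le_mul_of_nonneg_left (theta_mem hW hp0 hp hθ v).1 (mul_nonneg (hμ0 v) (hW v).le)
  · calc ∑ v, μ0 v * (W v * θ v) ≤ ∑ v, μ0 v * W v := sum_le_sum fun v _ =>
          mul_le_mul_of_nonneg_left (persist_le hW hp0 hp hθ v) (hμ0 v)
      _ = 1 := hμW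

/-! ## §2 The criterion in persistence form -/

variable {σ : ℝ} {z : S} {utX utY uX uY : S → ℝ} {qt q : S → S → ℝ} {Dn : S → S → ℝ} {D Φ e ρ : ℝ}

/-- **THE FINITE-ODDS CRITERION IN PERSISTENCE FORM.**  Weights `θ = 1/(1+pW)`, insertion term `e = 2(1−σ)θ_z + 2σθ̄`, tail laws `ũ_X, ũ_Y` (probability vectors) coupled
monotonically by `q̃`, `0 ≤ σ`; if `ρΔΦ ≤ σ·[G̃(Φ + e − 2) + pΔ·(2Σμ_0 Wθ − E_ũX Wθ − E_ũY Wθ)]` then `E_q[Δ'Φ'] ≤ (1−ρ)ΔΦ` for the mixture coupling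
`q = (1−σ)δ_(z,z) + σq̃`. [ours] -/
theorem finiteOdds_persistence_contract (hW : ∀ v, 0 < W v) (hp0 : 0 ≤ p) (hp : ∀ v, p * W v ≤ 1) (hθ : ∀ v, θ v = 1 / (1 + p * W v))
    (hμ1 : ∑ v, μ0 v = 1) (hσ0 : 0 ≤ σ) (hqt : IsCoupling utX utY qt) (hutX : ∑ a, utX a = 1) (hutY : ∑ b, utY b = 1)
    (hq : ∀ a b, q a b = (1 - σ) * ((if a = z then (1 : ℝ) else 0) * (if b = z then (1 : ℝ) else 0)) + σ * qt a b)
    (hDz : Dn z z = D) (hmono : ∀ a b, qt a b ≠ 0 → Dn a b ≤ D)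
    (he : e = 2 * (1 - σ) * θ z + 2 * σ * ∑ v, μ0 v * θ v)
    (hcrit : ρ * D * Φ ≤ σ * ((D - ∑ a, ∑ b, qt a b * Dn a b) * (Φ + e - 2)
        + p * D * (2 * ∑ v, μ0 v * (W v * θ v) - ∑ a, utX a * (W a * θ a) - ∑ b, utY b * (W b * θ b)))) :
    ∑ a, ∑ b, q a b * (Dn a b * (Φ + e - θ a - θ b)) ≤ (1 - ρ) * D * Φ := by
  refine finiteOdds_product_contract (rmax := 1) (rbar := ∑ v, μ0 v * θ v) hσ0 hqt hutX hq hDz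
    (fun v => (by have := (theta_mem hW hp0 hp hθ v).1; linarith)) (fun v => (theta_mem hW hp0 hp hθ v).2) hmono he ?_
  -- rewrite the deleted and fresh masses in persistence form
  rw [persist_expect hW hp0 hθ utX, persist_expect hW hp0 hθ utY, persist_fresh hW hp0 hθ hμ1, hutX, hutY]
  calc ρ * D * Φ ≤ _ := hcrit
    _ = σ * ((D - ∑ a, ∑ b, qt a b * Dn a b) * (Φ + e - 2 * 1)
        + D * (1 - p * ∑ v, utX v * (W v * θ v) + (1 - p * ∑ v, utY v * (W v * θ v)) - 2 * (1 - p * ∑ v, μ0 v * (W v * θ v)))) := by ring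

omit [DecidableEq S] in
/-- **Upper bounds on the two persistence expectations suffice** (the criterion is monotone in them): if `E_ũX Wθ ≤ P_X`, `E_ũY Wθ ≤ P_Y` and
`ρΔΦ ≤ σ·[G̃(Φ+e−2) + pΔ(2Σμ_0Wθ − P_X − P_Y)]` (`σ, p, Δ ≥ 0`) then the hypothesis `hcrit` of `finiteOdds_persistence_contract` holds. [ours] -/
theorem finiteOdds_persistence_criterion_of_le (hp0 : 0 ≤ p) (hσ0 : 0 ≤ σ) (hD0 : 0 ≤ D) {Gt PX PY Wθbar : ℝ}
    (hPX : ∑ a, utX a * (W a * θ a) ≤ PX) (hPY : ∑ b, utY b * (W b * θ b) ≤ PY)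
    (hcrit : ρ * D * Φ ≤ σ * (Gt * (Φ + e - 2) + p * D * (2 * Wθbar - PX - PY))) :
    ρ * D * Φ ≤ σ * (Gt * (Φ + e - 2) + p * D * (2 * Wθbar - ∑ a, utX a * (W a * θ a) - ∑ b, utY b * (W b * θ b))) := by
  have h : p * D * (2 * Wθbar - PX - PY) ≤ p * D * (2 * Wθbar - ∑ a, utX a * (W a * θ a) - ∑ b, utY b * (W b * θ b)) :=
    mul_le_mul_of_nonneg_left (by linarith) (mul_nonneg hp0 hD0)
  nlinarith [mul_le_mul_of_nonneg_left h hσ0]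

end Persistence

end Summit.Ventures.LatticeQCDFlow.Scaling
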